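import Literature.AlgebraicGeometry.Motives.AbelianVarietyTangentTranslation
import Literature.AlgebraicGeometry.Motives.CartierDivisor
import Literature.FieldTheory.Separability.KaehlerDifferentialFrobeniusKernel
import HarnessLib

/-!
# A homomorphism with zero tangent map has zero generic differential: `δλ = 0 ⇒ k(λx) ⊂ k(x^p)`
# (Shimura 1998, §2.8 Thm. 1 and Prop. 6 (i))

Topic `Literature/AlgebraicGeometry/Motives`, namespace `Literature.AlgebraicGeometry.Motives.AbelianVariety`.
Theorems only (no definition, no named fact; net Literature debt 0).  Cell `hodgecm-mathlib` (D-0151),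
fan A rung A-II (h21), EDITION E2 «height-one road» for the degree-one Shimura–Taniyama congruence,
pieces L2b/L2c of A-p02's memo `ROAD-E2-heightOne-S2degOne.md` §5.

Shimura, *Abelian Varieties with Complex Multiplication*, §2.8, proof of Thm. 1: for a homomorphism
`λ : A → B` and `F = {f ∘ λ | f ∈ k(B)} ⊂ k(A)`, «`(δλ ω) · D = 0` for all `ω ∈ 𝔇₀(B)` if and only if
`DF = 0`» for every derivation `D` of `k(A)` over `k`; Prop. 6 (i): «`δλ = 0` if and only if
`k(λx) ⊂ k(x^p)`».  We prove the direction used on p. 129 (proof of Thm. 18.6), in the tree's currency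
of tangent vectors as `L[ε]`-points (Görtz–Wedhorn II, Rem. 27.18 (4); `AbelianVarietyLie`,
`AbelianVarietyTangentTranslation`), taking for `L` the function field `F = K(A)` itself («generic tangent
vectors» = derivations of `K(A)`):

* `derivation_apply_stalkMap_genericPoint_eq_zero` — if `f : A → B` kills every `K(A)[ε]`-point of `A`
  at the origin, then EVERY `K`-derivation `D` of `K(A)` kills `f^♯(𝒪_{B,f(ξ)}) ⊂ K(A)` (`ξ` the generic
  point): the `K(A)[ε]`-point `r ↦ r + D(r)ε` at `ξ` is translated to the origin
  (`comp_eq_lift_comp_of_forall_tangent_comp_eq_one`), and `Spec 𝒪_{B,y} → B` is a monomorphism.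
* `kaehlerDifferential_D_stalkMap_genericPoint_eq_zero` — hence `d(f^♯ b) = 0` in `Ω[K(A)⁄K]`
  («`DF = 0` for all `D`» ⇔ «`dF = 0`», linear functionals on the `K(A)`-vector space `Ω[K(A)⁄K]`).
* `exists_pow_eq_stalkMap_genericPoint` — over a PERFECT `K` of characteristic `p`: `f^♯ b` is a `p`-th
  power in `K(A)` (Prop. 6 (i): `k(λx) ⊂ k(x^p)`), by `exists_pow_eq_of_kaehlerDifferential_D_eq_zero`
  (Matsumura §26, `KaehlerDifferentialFrobeniusKernel`).
* `…functionFieldMap…` — the same for the function-field map `K(B) → K(A)` of a dominant `f`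
  (`RatFn.functionFieldMap`).

The `K`-algebra structure on `K(A) = 𝒪_{A,ξ}` is taken as an instance argument pinned by the hypothesis
`hK : algebraMap K K(A) = (germ at ξ) ∘ (A → Spec K)^♯ ∘ ΓSpecIso⁻¹` (for Mathlib's `X.Over (Spec K)` /
the tree's `RatFn.algebraStalk` this is `rfl`), so that no instance is declared here.

## References

* [Shimura1998] G. Shimura, *Abelian Varieties with Complex Multiplication and Modular Functions*,
  Princeton 1998, §2.8, Thm. 1 (proof) and Prop. 6 (i) (pp. 23–26); §18.6 p. 129.
* [GortzWedhorn2023] U. Görtz, T. Wedhorn, *Algebraic Geometry II*, Rem. 27.18 (1)–(4).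
* [Matsumura1987] H. Matsumura, *Commutative Ring Theory*, §26, Thm. 26.5.
-/

universe u

open CategoryTheory AlgebraicGeometry TrivSqZeroExt
open scoped MonObj

noncomputable section

namespace Literature.AlgebraicGeometry.Motives

namespace AbelianVariety

open AlgPoints

variable {K : Type u} [Field K] {A B : AbelianVariety K}

/-- `Spec 𝒪_{A,x} → A → Spec K` is `Spec` of the structure map `K → Γ(A, 𝒪_A) → 𝒪_{A,x}` (as for the
origin in `AbelianVarietyLie.fromSpecStalk_origin_comp_hom`). [folklore] -/
private theorem fromSpecStalk_comp_hom (x : A.X.left) :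
    A.X.left.fromSpecStalk x ≫ A.X.hom =
      Spec.map (CommRingCat.ofHom ((A.X.left.presheaf.germ ⊤ x trivial).hom.comp
        (A.X.hom.appTop.hom.comp (Scheme.ΓSpecIso (.of K)).inv.hom))) := by
  rw [← Scheme.SpecMap_stalkMap_fromSpecStalk, Spec.fromSpecStalk_eq, ← Spec.map_comp,
    Category.assoc, Scheme.Hom.germ_stalkMap]
  rfl

/-- Two local-ring-valued points through `Spec 𝒪_{X,x} → X` with the same ring map are equal, and
conversely: `Spec 𝒪_{X,x} → X` is a monomorphism (Mathlib: a preimmersion). [folklore] -/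
private theorem ringHom_eq_of_SpecMap_comp_fromSpecStalk_eq {X : Scheme.{u}} {x : X} {R : CommRingCat.{u}}
    {g₁ g₂ : X.presheaf.stalk x ⟶ R}
    (h : Spec.map g₁ ≫ X.fromSpecStalk x = Spec.map g₂ ≫ X.fromSpecStalk x) : g₁ = g₂ :=
  Spec.map_injective ((cancel_mono (X.fromSpecStalk x)).mp h)

section GenericTangent

variable [Algebra K A.X.left.functionField]

/-- **Shimura §2.8 Thm. 1 (proof), generic-tangent-vector form.**  Let `f : A → B` be a homomorphism of
abelian varieties over `K` which kills every `K(A)[ε]`-point of `A` at the origin (every tangent vector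
at `e` with values in the function field `F = K(A)`).  Then every `K`-derivation `D : K(A) → K(A)` kills
the image of `𝒪_{B, f(ξ)}` under `f^♯_ξ` (`ξ` the generic point of `A`): «`DF = 0`».  Proof: the
`K(A)[ε]`-point `t_D : r ↦ r + D(r)ε` of `A` at `ξ` satisfies `t_D ≫ f =` the constant lift of its
reduction (`comp_eq_lift_comp_of_forall_tangent_comp_eq_one`); comparing the two ring maps
`𝒪_{B,f(ξ)} → K(A)[ε]` (`Spec 𝒪_{B,f(ξ)} → B` is a monomorphism) gives `D(f^♯ b) = 0`.
[cite: Shimura1998, §2.8 Thm. 1 (proof) and Prop. 6 (i)] [cite: GortzWedhorn2023, Rem. 27.18 (1)–(4)] -/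
theorem derivation_apply_stalkMap_genericPoint_eq_zero
    (hK : algebraMap K A.X.left.functionField =
      (A.X.left.presheaf.germ ⊤ (genericPoint A.X.left) trivial).hom.comp
        (A.X.hom.appTop.hom.comp (Scheme.ΓSpecIso (.of K)).inv.hom))
    (f : A ⟶ B)
    (hf : ∀ t : specOver K (DualNumber A.X.left.functionField) ⟶ A.X,
      specOverMapOfAlgHom (fstHom K A.X.left.functionField A.X.left.functionField) ≫ t = 1 →
        t ≫ f.hom.hom.hom = 1)
    (D : Derivation K A.X.left.functionField A.X.left.functionField)
    (b : B.X.left.presheaf.stalk (Hom.toSchemeHom f (genericPoint A.X.left))) :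
    D ((Hom.toSchemeHom f).stalkMap (genericPoint A.X.left) b) = 0 := by
  -- the `K`-algebra map `v_D : F → F[ε]`, `r ↦ r + D(r) ε` (`F = K(A)`)
  let vD : A.X.left.functionField →ₐ[K] DualNumber A.X.left.functionField :=
    { toFun := fun r => inl r + inr (D r)
      map_one' := by
        rw [Derivation.map_one_eq_zero, inr_zero, add_zero, inl_one]
      map_mul' := fun a b => by
        apply TrivSqZeroExt.ext
        · simp only [fst_add, fst_inl, fst_inr, add_zero, fst_mul]
        · simp only [snd_add, snd_inl, snd_inr, zero_add, snd_mul, fst_add, fst_inl, fst_inr,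
            add_zero, Derivation.leibniz, MulOpposite.smul_eq_mul_unop, MulOpposite.unop_op,
            smul_eq_mul]
          ring
      map_zero' := by rw [map_zero, inr_zero, add_zero, inl_zero]
      map_add' := fun a b => by
        rw [map_add, inl_add, inr_add]; abel
      commutes' := fun c => by
        rw [Derivation.map_algebraMap, inr_zero, add_zero, algebraMap_eq_inl'] }
  have hvD_snd : ∀ r, snd (vD r) = D r := fun r => by
    change snd (inl r + inr (D r)) = D r
    rw [snd_add, snd_inl, snd_inr, zero_add]
  -- the `F[ε]`-point `t_D` of `A` at the generic point `ξ`
  have hw : (Spec.map (CommRingCat.ofHom vD.toRingHom) ≫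
      A.X.left.fromSpecStalk (genericPoint A.X.left)) ≫ A.X.hom =
      (specOver K (DualNumber A.X.left.functionField)).hom := by
    rw [Category.assoc, fromSpecStalk_comp_hom, ← Spec.map_comp, ← hK]
    change Spec.map (CommRingCat.ofHom (vD.toRingHom.comp (algebraMap K _))) =
      Spec.map (CommRingCat.ofHom (algebraMap K (DualNumber A.X.left.functionField)))
    rw [vD.toRingHom_eq_coe, vD.comp_algebraMap]
  have key := comp_eq_lift_comp_of_forall_tangent_comp_eq_one A.X.left.functionField f hf
    (Over.homMk (Spec.map (CommRingCat.ofHom vD.toRingHom) ≫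
      A.X.left.fromSpecStalk (genericPoint A.X.left)) hw)
  -- translation: `t_D ≫ f` is the constant lift of its reduction; read on underlying schemes
  have key' : Spec.map (CommRingCat.ofHom vD.toRingHom) ≫
      (A.X.left.fromSpecStalk (genericPoint A.X.left) ≫ Hom.toSchemeHom f) =
      Spec.map (CommRingCat.ofHom (inlAlgHom K A.X.left.functionField
          A.X.left.functionField).toRingHom) ≫
        (Spec.map (CommRingCat.ofHom (fstHom K A.X.left.functionField
            A.X.left.functionField).toRingHom) ≫
          (Spec.map (CommRingCat.ofHom vD.toRingHom) ≫
            (A.X.left.fromSpecStalk (genericPoint A.X.left) ≫ Hom.toSchemeHom f))) := by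
    have h := congrArg (fun g => g.left) key
    simp only [Over.comp_left, Over.homMk_left, specOverMapOfAlgHom_left, Category.assoc] at h
    exact h
  -- both sides are `Spec (ring map) ≫ (Spec 𝒪_{B, f ξ} → B)`
  rw [← Scheme.SpecMap_stalkMap_fromSpecStalk] at key'
  simp only [← Spec.map_comp_assoc] at key'
  have hring := ringHom_eq_of_SpecMap_comp_fromSpecStalk_eq key'
  -- evaluate at `b` and read off the `ε`-component
  have happ := congrArg (fun g => snd (g.hom b)) hring
  simp only [CommRingCat.hom_comp, CommRingCat.hom_ofHom, RingHom.coe_comp, Function.comp_apply,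
    AlgHom.toRingHom_eq_coe, RingHom.coe_coe, hvD_snd] at happ
  rw [happ]
  simp [inlAlgHom_apply]

/-- **Shimura §2.8 Thm. 1 / Prop. 6 (i), differential form.**  Under the hypothesis of
`derivation_apply_stalkMap_genericPoint_eq_zero` (the tangent map of `f` vanishes on `K(A)`-valued
tangent vectors at the origin), `d(f^♯ b) = 0` in `Ω[K(A)⁄K]` for every `b ∈ 𝒪_{B, f(ξ)}`: a vector of the
`K(A)`-vector space `Ω[K(A)⁄K]` killed by every linear functional is zero, and functionals composed with
`d` are derivations. [cite: Shimura1998, §2.8 Thm. 1 (proof) and Prop. 6 (i)] -/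
theorem kaehlerDifferential_D_stalkMap_genericPoint_eq_zero
    (hK : algebraMap K A.X.left.functionField =
      (A.X.left.presheaf.germ ⊤ (genericPoint A.X.left) trivial).hom.comp
        (A.X.hom.appTop.hom.comp (Scheme.ΓSpecIso (.of K)).inv.hom))
    (f : A ⟶ B)
    (hf : ∀ t : specOver K (DualNumber A.X.left.functionField) ⟶ A.X,
      specOverMapOfAlgHom (fstHom K A.X.left.functionField A.X.left.functionField) ≫ t = 1 →
        t ≫ f.hom.hom.hom = 1)
    (b : B.X.left.presheaf.stalk (Hom.toSchemeHom f (genericPoint A.X.left))) :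
    KaehlerDifferential.D K A.X.left.functionField
      ((Hom.toSchemeHom f).stalkMap (genericPoint A.X.left) b) = 0 := by
  rw [← Module.forall_dual_apply_eq_zero_iff A.X.left.functionField]
  intro φ
  exact derivation_apply_stalkMap_genericPoint_eq_zero hK f hf
    (φ.compDer (KaehlerDifferential.D K A.X.left.functionField)) b

/-- **Shimura §2.8 Prop. 6 (i) («`δλ = 0 ⇒ k(λx) ⊂ k(x^p)`»), over a perfect ground field.**  If the
tangent map of `f : A → B` vanishes on `K(A)`-valued tangent vectors at the origin and `K` is perfect of
characteristic `p`, then every `f^♯ b` (`b ∈ 𝒪_{B,f(ξ)}`) is a `p`-th power in `K(A)` — the kernel of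
`d : K(A) → Ω[K(A)⁄K]` is `K(A)^p` (Matsumura §26, `exists_pow_eq_of_kaehlerDifferential_D_eq_zero`).
[cite: Shimura1998, §2.8 Prop. 6 (i); §18.6 p. 129] [cite: Matsumura1987, §26 Thm. 26.5] -/
theorem exists_pow_eq_stalkMap_genericPoint [PerfectField K] (p : ℕ) [Fact p.Prime] [CharP K p]
    (hK : algebraMap K A.X.left.functionField =
      (A.X.left.presheaf.germ ⊤ (genericPoint A.X.left) trivial).hom.comp
        (A.X.hom.appTop.hom.comp (Scheme.ΓSpecIso (.of K)).inv.hom))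
    (f : A ⟶ B)
    (hf : ∀ t : specOver K (DualNumber A.X.left.functionField) ⟶ A.X,
      specOverMapOfAlgHom (fstHom K A.X.left.functionField A.X.left.functionField) ≫ t = 1 →
        t ≫ f.hom.hom.hom = 1)
    (b : B.X.left.presheaf.stalk (Hom.toSchemeHom f (genericPoint A.X.left))) :
    ∃ c : A.X.left.functionField, c ^ p = (Hom.toSchemeHom f).stalkMap (genericPoint A.X.left) b := by
  haveI : CharP A.X.left.functionField p :=
    charP_of_injective_algebraMap (algebraMap K A.X.left.functionField).injective p
  exact Literature.FieldTheory.Separability.exists_pow_eq_of_kaehlerDifferential_D_eq_zero p _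
    (kaehlerDifferential_D_stalkMap_genericPoint_eq_zero hK f hf b)

/-- The same for the FUNCTION-FIELD MAP `K(B) → K(A)` of a dominant `f` (`RatFn.functionFieldMap`,
which is `f^♯_ξ` precomposed with `𝒪_{B,ξ_B} → 𝒪_{B,f(ξ)}`): every element of `f^*K(B)` is a `p`-th
power in `K(A)` — Shimura's «`k(λx) ⊂ k(x^p)`» verbatim. [cite: Shimura1998, §2.8 Prop. 6 (i); §18.6 p. 129] -/
theorem exists_pow_eq_functionFieldMap [PerfectField K] (p : ℕ) [Fact p.Prime] [CharP K p]
    (hK : algebraMap K A.X.left.functionField =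
      (A.X.left.presheaf.germ ⊤ (genericPoint A.X.left) trivial).hom.comp
        (A.X.hom.appTop.hom.comp (Scheme.ΓSpecIso (.of K)).inv.hom))
    (f : A ⟶ B) [IsDominant (Hom.toSchemeHom f)]
    (hf : ∀ t : specOver K (DualNumber A.X.left.functionField) ⟶ A.X,
      specOverMapOfAlgHom (fstHom K A.X.left.functionField A.X.left.functionField) ≫ t = 1 →
        t ≫ f.hom.hom.hom = 1)
    (b : B.X.left.functionField) :
    ∃ c : A.X.left.functionField, c ^ p = RatFn.functionFieldMap (Hom.toSchemeHom f) b := by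
  obtain ⟨c, hc⟩ := exists_pow_eq_stalkMap_genericPoint p hK f hf
    (B.X.left.presheaf.stalkSpecializes (RatFn.specializes_genericPoint (Hom.toSchemeHom f)) b)
  exact ⟨c, by rw [hc]; rfl⟩

end GenericTangent

end AbelianVariety

end Literature.AlgebraicGeometry.Motives

end
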